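import Summits.BirchSwinnertonDyer.BirchSwinnertonDyer.Theorems.SylvesterTwoHeegnerIndexUpperOffV0ReciprocityTwoOfPoitouTate
import Literature.NumberTheory.GaloisCohomology.PoitouTateNumberField
import HarnessLib

/-!
# K7t aside `UpperOffV0HSY` (stmt-BirchSwinnertonDyer-19581), line `offv0-kolyvagin2`:
# the registered stub (e) `stub_kolyvaginReciprocity_two` — UNCONDITIONAL

Route `SylvesterTwoHeegnerIndex` (cell bsd-cm, rung K7t), item stmt-BirchSwinnertonDyer-19581
`UpperOffV0HSY` (aside twin of 19804), registered skeleton 71f02d83b4c02269 (k7t-c2 g3, stubs (d)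
`stub_kolyvaginClasses_two`, (e) `stub_kolyvaginReciprocity_two`, (f)
`stub_upperOffV0_of_kolyvaginDescent_two`).

Stub (e) is Kolyvagin's reciprocity law (R)_M AT `p = 2` (McCallum 1991, §2 Prop. 2.2 / Gross 1991,
§7 (7.6), Prop. 8.2): for `K` imaginary quadratic (`d_K ∉ {-3, -4}`, Heegner hypothesis for `N`), a
non-torsion Heegner point, `M ≥ 1` and a Kolyvagin prime `ℓ` of level `2^M`, an alternating
left-non-degenerate pairing `e` on `E[2^M]` kills `([s, F], [c', σ])` for `s` Selmer, `c'` Selmer off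
`λ` and at `∞`, `F` a Frobenius at `𝔔 ∣ λ` fixing `E[2^M]`, `σ ∈ I_𝔔`.

k7t-c2 g5 landed it CONDITIONALLY on the Poitou–Tate named fact
(`SylvesterTwoUpper.stub_kolyvaginReciprocity_two_of_poitouTate`, file
`Theorems/SylvesterTwoHeegnerIndexUpperOffV0ReciprocityTwoOfPoitouTate.lean`, hypothesis
`hPT : ∀ K, poitouTate_sum_localTatePairing_eq_zero K`).  Since then the Poitou–Tate sum formula has
become a tree THEOREM over every number field `K : Type`
(`Literature.NumberTheory.GaloisCohomology.poitouTate_sum_localTatePairing_eq_zero_holds`, cn100,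
`Literature/NumberTheory/GaloisCohomology/PoitouTateNumberField.lean`), already consumed frame-free by
the live twin's lane (`SylvesterTwoCoupledDuality.kolyvaginReciprocityM_of_goodReduction`).

THIS FILE composes the two: the registered signature of stub (e), token for token, with NO hypothesis.
HONEST FRAMING: a two-line composition of tree theorems (the mathematics is x11b3's / k7t-c2 g5's /
cn100's); it closes the registered stub (e) of 19581 by name and nothing else — stubs (d) and (f) of
the line stay open (the crux content: Kolyvagin's derivative classes at `p = 2` and the
exponent-to-order step); no definition, no named fact, no `sorry`; BSD is claimed for no curve.

References: [McCallumLMS1991] §2 Prop. 2.2, §5 Lemma 5.3; [GrossLMS1991] §7 (7.1)–(7.6), Prop. 8.2;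
[MilneADT2006] I Thm. 4.10(b); [CasselsFrohlichANT1967] Ch. VII §11.
-/

set_option autoImplicit false
set_option linter.dupNamespace false -- Summits modules are `Summit.<Summit>.<Problem>…` by design

noncomputable section

open scoped Classical

namespace Summit.BirchSwinnertonDyer.BirchSwinnertonDyer.Theorems.SylvesterTwoUpper
open WeierstrassCurve NumberField IsDedekindDomain Field
open Literature.NumberTheory.EllipticCurves
open Literature.NumberTheory.GaloisRepresentations
open Literature.NumberTheory.GaloisCohomology

/-- **Stub (e) `stub_kolyvaginReciprocity_two` of line `offv0-kolyvagin2` (item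
stmt-BirchSwinnertonDyer-19581), registered signature VERBATIM, UNCONDITIONAL**: Kolyvagin's
reciprocity law (R)_M at `p = 2` — for `K` imaginary quadratic with `d_K ∉ {-3, -4}` and the Heegner
hypothesis for `N`, a non-torsion Heegner point, `M ≥ 1` and a Kolyvagin prime `ℓ` with
`Frob(ℓ) = Frob(∞)` on `K(E[2^M])`, there is an alternating left-non-degenerate pairing `e` on
`E[2^M]` with `e([s, F], [c', σ]) = 0` for `s ∈ Sel_{2^M}(E/K)`, `c'` Selmer off `λ` and at `∞`,
`𝔔 ∣ λ`, `F` an arithmetic Frobenius at `𝔔` fixing `E[2^M]`, `σ ∈ I_𝔔`.  Proof: k7t-c2 g5's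
conditional closer `stub_kolyvaginReciprocity_two_of_poitouTate` fed with the tree theorem
`poitouTate_sum_localTatePairing_eq_zero_holds` (Poitou–Tate over every number field).
[cite: McCallumLMS1991, §2 Prop. 2.2] [cite: GrossLMS1991, §7 (7.6), Prop. 8.2]
[cite: MilneADT2006, Ch. I Thm. 4.10(b)] -/
theorem stub_kolyvaginReciprocity_two :
    ∀ (N : ℕ) [NeZero N] (W : WeierstrassCurve ℚ) [W.IsElliptic] (K : Type) [Field K] [NumberField K] (_hK : IsImaginaryQuadratic K) (_hD : NumberField.discr K ≠ -3 ∧ NumberField.discr K ≠ -4) (_hH : SatisfiesHeegnerHypothesis N K) {P : (W.baseChange K).toAffine.Point} (_hP : IsHeegnerPoint N W K P) (_hnt : ¬ IsOfFinAddOrder P) {M : ℕ} (_hM : 1 ≤ M) {ℓ : ℕ} (hℓ : IsKolyvaginPrime N W K 2 ℓ), FrobEqFrobInfty W K (2 ^ M) ℓ → ∃ (A : Type) (_ : AddCommGroup A) (e : geomTorsion (W.baseChange K) ((2 ^ M : ℕ) : ℤ) →+ geomTorsion (W.baseChange K) ((2 ^ M : ℕ) : ℤ) →+ A), (∀ x,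 e x x = 0) ∧ (∀ x, (∀ y, e x y = 0) → x = 0) ∧ ∀ s ∈ selmerGroup (W.baseChange K) ((2 ^ M : ℕ) : ℤ), ∀ c' : galH1Torsion (W.baseChange K) ((2 ^ M : ℕ) : ℤ), (∀ v : HeightOneSpectrum (𝓞 K), (ℓ : 𝓞 K) ∉ v.asIdeal → c' ∈ selmerLocalKer (W.baseChange K) (v.adicCompletion K) ((2 ^ M : ℕ) : ℤ)) → (∀ w : InfinitePlace K, c' ∈ selmerLocalKer (W.baseChange K) w.Completion ((2 ^ M : ℕ) : ℤ)) → ∀ 𝔔 ∈ hℓ.place.primesAbove, ∀ F : Field.absoluteGaloisGroup K, IsArithFrobAt (𝓞 K) F 𝔔 → F ∈ torsionFixing (W.baseChange K) ((2 ^ M : ℕ) : ℤ) → ∀ σ ∈ 𝔔.inertia (Field.absoluteGaloisGroup K), e (h1Eval (W.baseChange K) ((2 ^ M : ℕ) : ℤ) s F) (h1Eval (W.baseChange K) ((2 ^ M : ℕ) : ℤ) c' σ) = 0 :=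
  stub_kolyvaginReciprocity_two_of_poitouTate
    (fun K _ _ ↦ poitouTate_sum_localTatePairing_eq_zero_holds K)

end Summit.BirchSwinnertonDyer.BirchSwinnertonDyer.Theorems.SylvesterTwoUpper

end
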